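import Summits.BirchSwinnertonDyer.BirchSwinnertonDyer.Theses.UniversalToricDescent

namespace Summit.BirchSwinnertonDyer.BirchSwinnertonDyer.Theses.UniversalToricDescent.RK6v3Certs

/-- the integral road (old package 26976, aside) still feeds the live binder. -/
theorem pkg3_of_old (h : ToricDefectWallMuAtThree) : ToricDefectEitherRoadMuAtThree := Or.inl h

/-- the integral wall is the k = 0 case of the rational wall (unchanged from v2). -/
theorem ratwall_of_wall (hw : AdditiveSplitIMCInclusionAtThree) : RationalSplitIMCInclusionAtThree := by
  intro W _ _ N _ K _ _ Dt hO6 hsurj hrk hN hK hH κ hκ γ _ 𝔭 h3 hram hdeg 𝔭' h3' hne ι' hι ΩK Ωp L hΩK hΩp hL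
  have h := hw W N K Dt hO6 hsurj hrk hN hK hH κ hκ γ 𝔭 h3 hram hdeg 𝔭' h3' hne ι' hι ΩK Ωp L hΩK hΩp hL
  rw [Ideal.span_singleton_le_iff_mem] at h
  exact ⟨0, by simpa using h⟩

/-- post-apply (rev 86): the live kernel binder hKr consumes exactly the rational-road sources, in this order
(the first five antecedents of stmt-24256's text; item CLOSED by p709833). -/
example (h : ToricKernelAtThreeApZeroOddRationalTwinMuOfPrint) (hF : ToricPublishedInputs) (hA : SigmaCongruenceAtThree)
    (hR : RationalSplitIMCInclusionAtThree) (hM : TwinMuZeroAtThree) (hT : TwinAlgMuZeroAtThree) :=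
  h hF hA hR hM hT

/-- post-apply (rev 86): the live package binder hP, right disjunct = the four rational-road sources. -/
example (hA : SigmaCongruenceAtThree) (hR : RationalSplitIMCInclusionAtThree) (hM : TwinMuZeroAtThree)
    (hT : TwinAlgMuZeroAtThree) : ToricDefectEitherRoadMuAtThree := Or.inr ⟨hA, hR, hM, hT⟩

end Summit.BirchSwinnertonDyer.BirchSwinnertonDyer.Theses.UniversalToricDescent.RK6v3Certs
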